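import Summits.Ventures.PercRepro.PuncturedLYMChain

open scoped Matroid

/-!
# PercRepro — (SP) BY SUPERPOSITION, PART 10: THE CHAIN INSTANCES — (SP) ON EVERY `(n, j)` WITH `2j + 1 ≤ n ≤ 3j − 3` FOR
`j ≤ 7`, AND ON `n ≥ 2j + 2` FOR `j = 8, 9` (p10, gen 31)

For each pair `(n, j)` below, the greedy certificate `λ_a = max 0 ((e(a) − a·λ_{a−1})/(j − a))` (an explicit rational
vector, computed exactly) satisfies the certificate inequalities and `Σ_{a<j} λ_a s_a + Σ_{a<j−1} λ_a s_a ≤ 1`, so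
`puncturedNMP_of_cert` gives (SP) for every code on `n` points at level `j`.  Together with THEOREM A (sharp) on
`n ≥ 3j − 2` this closes every `n ≥ 2j + 1` for `j ≤ 7` (`puncturedNMP_of_le_seven`).  The pairs `(17, 8)` and `(19, 9)`
(`n = 2j + 1`) are NOT closed by the chain certificate (its bound exceeds `1` by `.019` and `.051`).
All arithmetic is checked by `norm_num` on explicit binomial values (each `C(p, q) = v` by `decide`).
Nothing here asserts (SP) in general.
-/

namespace PercRepro.PuncturedLYM

open Finset

variable {α : Type} [Fintype α] [DecidableEq α]

/-- (SP) on `(9, 4)` from the greedy certificate. -/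
theorem inst_9_4 (hcard : Fintype.card α = 9) {D : Finset (Finset α)} (hD : IsCode 4 D) : PuncturedNMP 4 D := by
  refine puncturedNMP_of_cert hD (by norm_num) (by omega) (fun a => if a = 0 then ((1 : ℚ) / 504) else if a = 1 then ((17 : ℚ) / 6048) else if a = 2 then ((37 : ℚ) / 6048) else if a = 3 then ((1 : ℚ) / 24) else (0 : ℚ)) ?_ ?_ ?_
  · intro a ha
    interval_cases a <;> norm_num
  · intro a ha
    interval_cases a <;>
      norm_num [eDef, dFlux, tauQ, cumCount, classCount, cutEdges, hcard, Finset.sum_range_succ, Nat.choose]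
  · norm_num [sQ, hcard, Finset.sum_range_succ, Nat.choose]

/-- (SP) on `(11, 5)` from the greedy certificate. -/
theorem inst_11_5 (hcard : Fintype.card α = 11) {D : Finset (Finset α)} (hD : IsCode 5 D) : PuncturedNMP 5 D := by
  refine puncturedNMP_of_cert hD (by norm_num) (by omega) (fun a => if a = 0 then ((1 : ℚ) / 2310) else if a = 1 then ((13 : ℚ) / 23100) else if a = 2 then ((43 : ℚ) / 46200) else if a = 3 then ((3 : ℚ) / 1100) else if a = 4 then ((1 : ℚ) / 35) else (0 : ℚ)) ?_ ?_ ?_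
  · intro a ha
    interval_cases a <;> norm_num
  · intro a ha
    interval_cases a <;>
      norm_num [eDef, dFlux, tauQ, cumCount, classCount, cutEdges, hcard, Finset.sum_range_succ, Nat.choose]
  · norm_num [sQ, hcard, Finset.sum_range_succ, Nat.choose]

/-- (SP) on `(12, 5)` from the greedy certificate. -/
theorem inst_12_5 (hcard : Fintype.card α = 12) {D : Finset (Finset α)} (hD : IsCode 5 D) : PuncturedNMP 5 D := by
  refine puncturedNMP_of_cert hD (by norm_num) (by omega) (fun a => if a = 0 then ((1 : ℚ) / 3960) else if a = 1 then ((3 : ℚ) / 8800) else if a = 2 then ((1 : ℚ) / 1650) else if a = 3 then ((1 : ℚ) / 495) else if a = 4 then ((1 : ℚ) / 40) else (0 : ℚ)) ?_ ?_ ?_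
  · intro a ha
    interval_cases a <;> norm_num
  · intro a ha
    interval_cases a <;>
      norm_num [eDef, dFlux, tauQ, cumCount, classCount, cutEdges, hcard, Finset.sum_range_succ, Nat.choose]
  · norm_num [sQ, hcard, Finset.sum_range_succ, Nat.choose]

/-- (SP) on `(13, 6)` from the greedy certificate. -/
theorem inst_13_6 (hcard : Fintype.card α = 13) {D : Finset (Finset α)} (hD : IsCode 6 D) : PuncturedNMP 6 D := by
  refine puncturedNMP_of_cert hD (by norm_num) (by omega) (fun a => if a = 0 then ((1 : ℚ) / 10296) else if a = 1 then ((37 : ℚ) / 308880) else if a = 2 then ((59 : ℚ) / 343200) else if a = 3 then ((1 : ℚ) / 2925) else if a = 4 then ((211 : ℚ) / 154440) else if a = 5 then ((1 : ℚ) / 48) else (0 : ℚ)) ?_ ?_ ?_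
  · intro a ha
    interval_cases a <;> norm_num
  · intro a ha
    interval_cases a <;>
      norm_num [eDef, dFlux, tauQ, cumCount, classCount, cutEdges, hcard, Finset.sum_range_succ, Nat.choose]
  · norm_num [sQ, hcard, Finset.sum_range_succ, Nat.choose]

/-- (SP) on `(14, 6)` from the greedy certificate. -/
theorem inst_14_6 (hcard : Fintype.card α = 14) {D : Finset (Finset α)} (hD : IsCode 6 D) : PuncturedNMP 6 D := by
  refine puncturedNMP_of_cert hD (by norm_num) (by omega) (fun a => if a = 0 then ((1 : ℚ) / 18018) else if a = 1 then ((19 : ℚ) / 270270) else if a = 2 then ((1 : ℚ) / 9450) else if a = 3 then ((31 : ℚ) / 135135) else if a = 4 then ((283 : ℚ) / 270270) else if a = 5 then ((1 : ℚ) / 54) else (0 : ℚ)) ?_ ?_ ?_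
  · intro a ha
    interval_cases a <;> norm_num
  · intro a ha
    interval_cases a <;>
      norm_num [eDef, dFlux, tauQ, cumCount, classCount, cutEdges, hcard, Finset.sum_range_succ, Nat.choose]
  · norm_num [sQ, hcard, Finset.sum_range_succ, Nat.choose]

/-- (SP) on `(15, 6)` from the greedy certificate. -/
theorem inst_15_6 (hcard : Fintype.card α = 15) {D : Finset (Finset α)} (hD : IsCode 6 D) : PuncturedNMP 6 D := by
  refine puncturedNMP_of_cert hD (by norm_num) (by omega) (fun a => if a = 0 then ((1 : ℚ) / 30030) else if a = 1 then ((1 : ℚ) / 23100) else if a = 2 then ((41 : ℚ) / 600600) else if a = 3 then ((193 : ℚ) / 1201200) else if a = 4 then ((71 : ℚ) / 85800) else if a = 5 then ((1 : ℚ) / 60) else (0 : ℚ)) ?_ ?_ ?_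
  · intro a ha
    interval_cases a <;> norm_num
  · intro a ha
    interval_cases a <;>
      norm_num [eDef, dFlux, tauQ, cumCount, classCount, cutEdges, hcard, Finset.sum_range_succ, Nat.choose]
  · norm_num [sQ, hcard, Finset.sum_range_succ, Nat.choose]

/-- (SP) on `(15, 7)` from the greedy certificate. -/
theorem inst_15_7 (hcard : Fintype.card α = 15) {D : Finset (Finset α)} (hD : IsCode 7 D) : PuncturedNMP 7 D := by
  refine puncturedNMP_of_cert hD (by norm_num) (by omega) (fun a => if a = 0 then ((1 : ℚ) / 45045) else if a = 1 then ((5 : ℚ) / 189189) else if a = 2 then ((1 : ℚ) / 28665) else if a = 3 then ((89 : ℚ) / 1576575) else if a = 4 then ((131 : ℚ) / 945945) else if a = 5 then ((79 : ℚ) / 105105) else if a = 6 then ((1 : ℚ) / 63) else (0 : ℚ)) ?_ ?_ ?_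
  · intro a ha
    interval_cases a <;> norm_num
  · intro a ha
    interval_cases a <;>
      norm_num [eDef, dFlux, tauQ, cumCount, classCount, cutEdges, hcard, Finset.sum_range_succ, Nat.choose]
  · norm_num [sQ, hcard, Finset.sum_range_succ, Nat.choose]

/-- (SP) on `(16, 7)` from the greedy certificate. -/
theorem inst_16_7 (hcard : Fintype.card α = 16) {D : Finset (Finset α)} (hD : IsCode 7 D) : PuncturedNMP 7 D := by
  refine puncturedNMP_of_cert hD (by norm_num) (by omega) (fun a => if a = 0 then ((1 : ℚ) / 80080) else if a = 1 then ((17 : ℚ) / 1121120) else if a = 2 then ((29 : ℚ) / 1401400) else if a = 3 then ((199 : ℚ) / 5605600) else if a = 4 then ((269 : ℚ) / 2802800) else if a = 5 then ((19 : ℚ) / 32032) else if a = 6 then ((1 : ℚ) / 70) else (0 : ℚ)) ?_ ?_ ?_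
  · intro a ha
    interval_cases a <;> norm_num
  · intro a ha
    interval_cases a <;>
      norm_num [eDef, dFlux, tauQ, cumCount, classCount, cutEdges, hcard, Finset.sum_range_succ, Nat.choose]
  · norm_num [sQ, hcard, Finset.sum_range_succ, Nat.choose]

/-- (SP) on `(17, 7)` from the greedy certificate. -/
theorem inst_17_7 (hcard : Fintype.card α = 17) {D : Finset (Finset α)} (hD : IsCode 7 D) : PuncturedNMP 7 D := by
  refine puncturedNMP_of_cert hD (by norm_num) (by omega) (fun a => if a = 0 then ((1 : ℚ) / 136136) else if a = 1 then ((1 : ℚ) / 109956) else if a = 2 then ((5 : ℚ) / 389844) else if a = 3 then ((111 : ℚ) / 4764760) else if a = 4 then ((47 : ℚ) / 680680) else if a = 5 then ((7 : ℚ) / 14586) else if a = 6 then ((1 : ℚ) / 77) else (0 : ℚ)) ?_ ?_ ?_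
  · intro a ha
    interval_cases a <;> norm_num
  · intro a ha
    interval_cases a <;>
      norm_num [eDef, dFlux, tauQ, cumCount, classCount, cutEdges, hcard, Finset.sum_range_succ, Nat.choose]
  · norm_num [sQ, hcard, Finset.sum_range_succ, Nat.choose]

/-- (SP) on `(18, 7)` from the greedy certificate. -/
theorem inst_18_7 (hcard : Fintype.card α = 18) {D : Finset (Finset α)} (hD : IsCode 7 D) : PuncturedNMP 7 D := by
  refine puncturedNMP_of_cert hD (by norm_num) (by omega) (fun a => if a = 0 then ((1 : ℚ) / 222768) else if a = 1 then ((53 : ℚ) / 9356256) else if a = 2 then ((193 : ℚ) / 23390640) else if a = 3 then ((353 : ℚ) / 22276800) else if a = 4 then ((107 : ℚ) / 2088450) else if a = 5 then ((331 : ℚ) / 835380) else if a = 6 then ((1 : ℚ) / 84) else (0 : ℚ)) ?_ ?_ ?_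
  · intro a ha
    interval_cases a <;> norm_num
  · intro a ha
    interval_cases a <;>
      norm_num [eDef, dFlux, tauQ, cumCount, classCount, cutEdges, hcard, Finset.sum_range_succ, Nat.choose]
  · norm_num [sQ, hcard, Finset.sum_range_succ, Nat.choose]

/-- (SP) on `(18, 8)` from the greedy certificate. -/
theorem inst_18_8 (hcard : Fintype.card α = 18) {D : Finset (Finset α)} (hD : IsCode 8 D) : PuncturedNMP 8 D := by
  refine puncturedNMP_of_cert hD (by norm_num) (by omega) (fun a => if a = 0 then ((1 : ℚ) / 350064) else if a = 1 then ((1 : ℚ) / 297024) else if a = 2 then ((37 : ℚ) / 8576568) else if a = 3 then ((1 : ℚ) / 155232) else if a = 4 then ((23 : ℚ) / 1786785) else if a = 5 then ((431 : ℚ) / 9801792) else if a = 6 then ((883 : ℚ) / 2450448) else if a = 7 then ((1 : ℚ) / 88) else (0 : ℚ)) ?_ ?_ ?_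
  · intro a ha
    interval_cases a <;> norm_num
  · intro a ha
    interval_cases a <;>
      norm_num [eDef, dFlux, tauQ, cumCount, classCount, cutEdges, hcard, Finset.sum_range_succ, Nat.choose]
  · norm_num [sQ, hcard, Finset.sum_range_succ, Nat.choose]

/-- (SP) on `(19, 8)` from the greedy certificate. -/
theorem inst_19_8 (hcard : Fintype.card α = 19) {D : Finset (Finset α)} (hD : IsCode 8 D) : PuncturedNMP 8 D := by
  refine puncturedNMP_of_cert hD (by norm_num) (by omega) (fun a => if a = 0 then ((1 : ℚ) / 604656) else if a = 1 then ((67 : ℚ) / 33860736) else if a = 2 then ((1847 : ℚ) / 711075456) else if a = 3 then ((4787 : ℚ) / 1185125760) else if a = 4 then ((7307 : ℚ) / 846518400) else if a = 5 then ((2063 : ℚ) / 63488880) else if a = 6 then ((1049 : ℚ) / 3527160) else if a = 7 then ((1 : ℚ) / 96) else (0 : ℚ)) ?_ ?_ ?_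
  · intro a ha
    interval_cases a <;> norm_num
  · intro a ha
    interval_cases a <;>
      norm_num [eDef, dFlux, tauQ, cumCount, classCount, cutEdges, hcard, Finset.sum_range_succ, Nat.choose]
  · norm_num [sQ, hcard, Finset.sum_range_succ, Nat.choose]

/-- (SP) on `(20, 8)` from the greedy certificate. -/
theorem inst_20_8 (hcard : Fintype.card α = 20) {D : Finset (Finset α)} (hD : IsCode 8 D) : PuncturedNMP 8 D := by
  refine puncturedNMP_of_cert hD (by norm_num) (by omega) (fun a => if a = 0 then ((1 : ℚ) / 1007760) else if a = 1 then ((1 : ℚ) / 829920) else if a = 2 then ((1 : ℚ) / 617253) else if a = 3 then ((37 : ℚ) / 14108640) else if a = 4 then ((211 : ℚ) / 35271600) else if a = 5 then ((29 : ℚ) / 1175720) else if a = 6 then ((587 : ℚ) / 2351440) else if a = 7 then ((1 : ℚ) / 104) else (0 : ℚ)) ?_ ?_ ?_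
  · intro a ha
    interval_cases a <;> norm_num
  · intro a ha
    interval_cases a <;>
      norm_num [eDef, dFlux, tauQ, cumCount, classCount, cutEdges, hcard, Finset.sum_range_succ, Nat.choose]
  · norm_num [sQ, hcard, Finset.sum_range_succ, Nat.choose]

/-- (SP) on `(21, 8)` from the greedy certificate. -/
theorem inst_21_8 (hcard : Fintype.card α = 21) {D : Finset (Finset α)} (hD : IsCode 8 D) : PuncturedNMP 8 D := by
  refine puncturedNMP_of_cert hD (by norm_num) (by omega) (fun a => if a = 0 then ((1 : ℚ) / 1627920) else if a = 1 then ((23 : ℚ) / 30387840) else if a = 2 then ((1 : ℚ) / 959616) else if a = 3 then ((1 : ℚ) / 569772) else if a = 4 then ((27 : ℚ) / 6330800) else if a = 5 then ((97 : ℚ) / 5064640) else if a = 6 then ((3229 : ℚ) / 15193920) else if a = 7 then ((1 : ℚ) / 112) else (0 : ℚ)) ?_ ?_ ?_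
  · intro a ha
    interval_cases a <;> norm_num
  · intro a ha
    interval_cases a <;>
      norm_num [eDef, dFlux, tauQ, cumCount, classCount, cutEdges, hcard, Finset.sum_range_succ, Nat.choose]
  · norm_num [sQ, hcard, Finset.sum_range_succ, Nat.choose]

/-- (SP) on `(20, 9)` from the greedy certificate. -/
theorem inst_20_9 (hcard : Fintype.card α = 20) {D : Finset (Finset α)} (hD : IsCode 9 D) : PuncturedNMP 9 D := by
  refine puncturedNMP_of_cert hD (by norm_num) (by omega) (fun a => if a = 0 then ((1 : ℚ) / 1511640) else if a = 1 then ((83 : ℚ) / 108838080) else if a = 2 then ((713 : ℚ) / 761866560) else if a = 3 then ((2729 : ℚ) / 2133226368) else if a = 4 then ((5669 : ℚ) / 2666532960) else if a = 5 then ((1537 : ℚ) / 304746624) else if a = 6 then ((1663 : ℚ) / 76186656) else if a = 7 then ((1679 : ℚ) / 7255872) else if a = 8 then ((1 : ℚ) / 108) else (0 : ℚ)) ?_ ?_ ?_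
  · intro a ha
    interval_cases a <;> norm_num
  · intro a ha
    interval_cases a <;>
      norm_num [eDef, dFlux, tauQ, cumCount, classCount, cutEdges, hcard, Finset.sum_range_succ, Nat.choose]
  · norm_num [sQ, hcard, Finset.sum_range_succ, Nat.choose]

/-- (SP) on `(21, 9)` from the greedy certificate. -/
theorem inst_21_9 (hcard : Fintype.card α = 21) {D : Finset (Finset α)} (hD : IsCode 9 D) : PuncturedNMP 9 D := by
  refine puncturedNMP_of_cert hD (by norm_num) (by omega) (fun a => if a = 0 then ((1 : ℚ) / 2645370) else if a = 1 then ((1 : ℚ) / 2267460) else if a = 2 then ((1 : ℚ) / 1813968) else if a = 3 then ((23 : ℚ) / 29628144) else if a = 4 then ((43 : ℚ) / 31744440) else if a = 5 then ((11 : ℚ) / 3174444) else if a = 6 then ((5 : ℚ) / 302328) else if a = 7 then ((137 : ℚ) / 705432) else if a = 8 then ((1 : ℚ) / 117) else (0 : ℚ)) ?_ ?_ ?_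
  · intro a ha
    interval_cases a <;> norm_num
  · intro a ha
    interval_cases a <;>
      norm_num [eDef, dFlux, tauQ, cumCount, classCount, cutEdges, hcard, Finset.sum_range_succ, Nat.choose]
  · norm_num [sQ, hcard, Finset.sum_range_succ, Nat.choose]

/-- (SP) on `(22, 9)` from the greedy certificate. -/
theorem inst_22_9 (hcard : Fintype.card α = 22) {D : Finset (Finset α)} (hD : IsCode 9 D) : PuncturedNMP 9 D := by
  refine puncturedNMP_of_cert hD (by norm_num) (by omega) (fun a => if a = 0 then ((1 : ℚ) / 4476780) else if a = 1 then ((1 : ℚ) / 3792096) else if a = 2 then ((101 : ℚ) / 300839616) else if a = 3 then ((293 : ℚ) / 601679232) else if a = 4 then ((503 : ℚ) / 564074280) else if a = 5 then ((41 : ℚ) / 16713312) else if a = 6 then ((643 : ℚ) / 50139936) else if a = 7 then ((1015 : ℚ) / 6139584) else if a = 8 then ((1 : ℚ) / 126) else (0 : ℚ)) ?_ ?_ ?_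
  · intro a ha
    interval_cases a <;> norm_num
  · intro a ha
    interval_cases a <;>
      norm_num [eDef, dFlux, tauQ, cumCount, classCount, cutEdges, hcard, Finset.sum_range_succ, Nat.choose]
  · norm_num [sQ, hcard, Finset.sum_range_succ, Nat.choose]

/-- (SP) on `(23, 9)` from the greedy certificate. -/
theorem inst_23_9 (hcard : Fintype.card α = 23) {D : Finset (Finset α)} (hD : IsCode 9 D) : PuncturedNMP 9 D := by
  refine puncturedNMP_of_cert hD (by norm_num) (by omega) (fun a => if a = 0 then ((1 : ℚ) / 7354710) else if a = 1 then ((43 : ℚ) / 264769560) else if a = 2 then ((223 : ℚ) / 1059078240) else if a = 3 then ((53 : ℚ) / 168489720) else if a = 4 then ((311 : ℚ) / 514829700) else if a = 5 then ((367 : ℚ) / 205931880) else if a = 6 then ((4177 : ℚ) / 411863760) else if a = 7 then ((12571 : ℚ) / 88256520) else if a = 8 then ((1 : ℚ) / 135) else (0 : ℚ)) ?_ ?_ ?_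
  · intro a ha
    interval_cases a <;> norm_num
  · intro a ha
    interval_cases a <;>
      norm_num [eDef, dFlux, tauQ, cumCount, classCount, cutEdges, hcard, Finset.sum_range_succ, Nat.choose]
  · norm_num [sQ, hcard, Finset.sum_range_succ, Nat.choose]

/-- (SP) on `(24, 9)` from the greedy certificate. -/
theorem inst_24_9 (hcard : Fintype.card α = 24) {D : Finset (Finset α)} (hD : IsCode 9 D) : PuncturedNMP 9 D := by
  refine puncturedNMP_of_cert hD (by norm_num) (by omega) (fun a => if a = 0 then ((1 : ℚ) / 11767536) else if a = 1 then ((29 : ℚ) / 282420864) else if a = 2 then ((67 : ℚ) / 494236512) else if a = 3 then ((481 : ℚ) / 2306437056) else if a = 4 then ((11 : ℚ) / 26209512) else if a = 5 then ((509 : ℚ) / 384406176) else if a = 6 then ((409 : ℚ) / 50139936) else if a = 7 then ((13619 : ℚ) / 109830336) else if a = 8 then ((1 : ℚ) / 144) else (0 : ℚ)) ?_ ?_ ?_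
  · intro a ha
    interval_cases a <;> norm_num
  · intro a ha
    interval_cases a <;>
      norm_num [eDef, dFlux, tauQ, cumCount, classCount, cutEdges, hcard, Finset.sum_range_succ, Nat.choose]
  · norm_num [sQ, hcard, Finset.sum_range_succ, Nat.choose]

/-! ### The corank-bounded theorems -/

/-- **(SP) for every code with `1 ≤ j ≤ 7` and `2j + 1 ≤ n`** (the matching theorem at `j = 2`, Theorem C at `j = 1`,
Theorem A sharp at `3j ≤ n + 2`, the chain instances in between). -/
theorem puncturedNMP_of_le_seven {j : ℕ} {D : Finset (Finset α)} (hD : IsCode j D) (hj1 : 1 ≤ j) (hj : j ≤ 7)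
    (hn : 2 * j + 1 ≤ Fintype.card α) : PuncturedNMP j D := by
  rcases Nat.lt_or_ge (Fintype.card α + 2) (3 * j) with hlt | hge
  · -- the finite window `2j + 1 ≤ n ≤ 3j − 3`, `j ≥ 4`
    obtain ⟨n, hcard⟩ : ∃ n, Fintype.card α = n := ⟨_, rfl⟩
    rw [hcard] at hlt hn
    interval_cases j
    · omega
    · omega
    · omega
    · have hub : n ≤ 9 := by omega
      interval_cases n
      exact inst_9_4 hcard hD
    · have hub : n ≤ 12 := by omega
      interval_cases n
      · exact inst_11_5 hcard hD
      · exact inst_12_5 hcard hD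
    · have hub : n ≤ 15 := by omega
      interval_cases n
      · exact inst_13_6 hcard hD
      · exact inst_14_6 hcard hD
      · exact inst_15_6 hcard hD
    · have hub : n ≤ 18 := by omega
      interval_cases n
      · exact inst_15_7 hcard hD
      · exact inst_16_7 hcard hD
      · exact inst_17_7 hcard hD
      · exact inst_18_7 hcard hD
  · rcases Nat.lt_or_ge j 3 with hj3 | hj3
    · interval_cases j
      · -- `j = 1`: at most one word, Theorem C
        apply puncturedNMP_of_few_words hD le_rfl hn
        have : D.card ≤ 1 := by
          rw [card_le_one]
          intro B hB B' hB'
          by_contra hne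
          have := hD.2 B hB B' hB' hne
          omega
        omega
      · exact puncturedNMP_of_matching hD
    · exact puncturedNMP_of_three_j' hD hj3 hn hge

/-- **(SP) for every code with `j ∈ {8, 9}` and `2j + 2 ≤ n`** (the chain instances and Theorem A sharp; `n = 2j + 1` open). -/
theorem puncturedNMP_of_eight_nine {j : ℕ} {D : Finset (Finset α)} (hD : IsCode j D) (hj8 : 8 ≤ j) (hj : j ≤ 9)
    (hn : 2 * j + 2 ≤ Fintype.card α) : PuncturedNMP j D := by
  rcases Nat.lt_or_ge (Fintype.card α + 2) (3 * j) with hlt | hge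
  · obtain ⟨n, hcard⟩ : ∃ n, Fintype.card α = n := ⟨_, rfl⟩
    rw [hcard] at hlt hn
    interval_cases j
    · have hub : n ≤ 21 := by omega
      interval_cases n
      · exact inst_18_8 hcard hD
      · exact inst_19_8 hcard hD
      · exact inst_20_8 hcard hD
      · exact inst_21_8 hcard hD
    · have hub : n ≤ 24 := by omega
      interval_cases n
      · exact inst_20_9 hcard hD
      · exact inst_21_9 hcard hD
      · exact inst_22_9 hcard hD
      · exact inst_23_9 hcard hD
      · exact inst_24_9 hcard hD
  · exact puncturedNMP_of_three_j' hD (by omega) (by omega) hge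

omit [Fintype α] in
/-- (SP) inside any finset `E` for `1 ≤ j ≤ 7`, `2j + 1 ≤ #E`. -/
theorem puncturedNMP_in_of_le_seven {E : Finset α} {j : ℕ} {D : Finset (Finset α)} (hD : IsCodeIn j E D)
    (hj1 : 1 ≤ j) (hj : j ≤ 7) (hn : 2 * j + 1 ≤ E.card) : PuncturedNMPIn j E D := by
  apply puncturedNMP_in_of_subtype hD
  apply puncturedNMP_of_le_seven (isCode_image_toSub hD) hj1 hj
  rw [Fintype.card_coe]
  exact hn

end PercRepro.PuncturedLYM

namespace PercRepro.Cogirth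

open Finset ThmH Skew

variable {α : Type} [DecidableEq α] {M : Matroid α} [M.Finite]

/-- **(NC) for every sparse paving matroid of corank `n − r ≤ 7`** with `r + 1 ≤ n` and `n + 2 ≤ 2r`. -/
theorem normConsAt_of_sparsePaving_corank_le_seven {r : ℕ} (hsp : IsSparsePavingF M r) (hr1 : r + 1 ≤ (gr M).card)
    (hn : (gr M).card + 2 ≤ 2 * r) (h7 : (gr M).card - r ≤ 7) : NormConsAt M := by
  intro U hU j
  have hr : r ≤ (gr M).card := by omega
  rcases Nat.lt_or_ge j ((gr M).card - r) with hlt | hge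
  · apply normConsStep_of_lt
    rw [hsp.1]
    omega
  rcases Nat.eq_or_lt_of_le hge with heq | hgt
  · rw [← heq]
    apply normConsStep_bottom_of_puncturedNMPIn hsp hn hU
    exact PuncturedLYM.puncturedNMP_in_of_le_seven (isCodeIn_cocode hsp hr) (by omega) h7 (by omega)
  rcases Nat.lt_or_ge (j + 1) r with hmid | htop
  · apply normConsStep_of_indep_succ_of_indep_sdiff hU (by omega)
    · intro S hS hSc
      exact rk_eq_card_of_card_lt_of_sparsePaving hsp hr hS (by omega)
    · intro S hS hSc
      exact rk_eq_card_of_card_lt_of_sparsePaving hsp hr hS (by omega)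
  · apply normConsStep_of_rk_le hU
    rw [hsp.1]
    omega

end PercRepro.Cogirth
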